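import Summits.HodgeConjecture.HodgeConjecture.Theorems.PadicSemiregularLiftHodgeBeyondAnchorsThomLineTransport
import Literature.AlgebraicGeometry.HodgeTheory.SupportedClassesPurity
import Literature.AlgebraicGeometry.HodgeTheory.MovingLemmaExcessInduction
import Literature.AlgebraicGeometry.HodgeTheory.GysinFormalismCorrespondences
import Literature.AlgebraicGeometry.Motives.FiniteMorphismCodimension
import Literature.AlgebraicTopology.SingularHomology.LocallyFlatPairMapBox
import Literature.AlgebraicTopology.SingularHomology.KroneckerPairingLocality
import Literature.NumberTheory.Transcendental.AnalytificationClosure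
import Literature.NumberTheory.Transcendental.AnalytificationConnectedOpen
import HarnessLib

/-!
# (Θ) Transport of the Thom line along a finite map — crux `HodgeBeyondAnchors` (stmt-HodgeConjecture-14054), line `andre-motivated-split`

Helper for the cone step of Chow's moving lemma on the coniveau carrier (lead c2 of the crux line,
`Cruxes/HodgeBeyondAnchors/Lines/andre_motivated_split.lean`, theorem `coneStep`). For a FINITE
morphism `φ : X ⟶ Y` of smooth projective complex `n`-folds, an irreducible closed `Z ⊆ X` of
codimension `≥ l ≥ 1`, a closed `Z'` with `φ⁻¹(φ Z) ⊆ Z ∪ Z'`, and ONE complex point of `Z` at which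
`φ(ℂ)` is a local homeomorphism, every class of `H²ˡ(X(ℂ); ℂ)` dying off `Z` is a multiple of
`φ^* b` modulo classes dying off `Z'`, for ANY non-zero `b ∈ H²ˡ(Y(ℂ); ℂ)` dying off `φ(Z)`
(`stub_coneTransport`, the registered stub (Θ) of the line; Voisin, *Hodge Theory II* §9.2.4, proof of Lemma 9.22: "`Z` appears with
multiplicity one in `φ⁻¹(φ(Z))`", read in singular cohomology with supports; Fulton *Intersection
Theory* §19.1 eq. (3) and Lemma 19.1.1). Ingredients: the LANDED topological Thom-line transport
`stub_thomLineTransport` (p140530), straightening of `Z` and `φ(Z)` off closed sets of codimension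
`≥ l + 1` (`GAGADimension.exists_closed_straightening_off`), codimension book-keeping of finite
morphisms (`Motives/FiniteMorphismCodimension`), semipurity (`injective_restrictCompl_of_le_coheight`,
`ker_restrictCompl_union_le`), and the density of Zariski-dense opens of an irreducible `Z` in the
complex topology (`exists_mem_pt_mem_pt_not_mem`, SGA1 XII Prop. 2.2 via
`ComplexPoints.preimage_pt_closure_eq`). Everything here is proved (no named facts).

## References
* [VoisinHodgeII2003] C. Voisin, Hodge Theory and Complex Algebraic Geometry II, CUP 2003, §9.2.4 Lemma 9.22.
* [Fulton1998] W. Fulton, Intersection Theory, 2nd ed., Springer 1998, §19.1.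
* [SGA1] A. Grothendieck, M. Raynaud, SGA 1, Exp. XII, Prop. 2.2.

#harness_tags algebraic_geometry.hodge_theory, algebraic_topology.singular_cohomology
-/

set_option linter.dupNamespace false

noncomputable section

open CategoryTheory AlgebraicGeometry Order Set TopologicalSpace
open Literature.AlgebraicTopology.SingularHomology
open Literature.AlgebraicGeometry.Motives Literature.AlgebraicGeometry.HodgeTheory

namespace Summit.HodgeConjecture.HodgeConjecture.Theorems.HodgeBeyondAnchors

/-- Restriction to a smaller Zariski-open factors: if `Z ⊆ Z'` then a class dying off `Z` dies off `Z'`. -/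
theorem ker_restrictCompl_mono {X : SchemeOver ℂ} {Z Z' : Set X.left} (h : Z ⊆ Z') (i : ℕ) :
    LinearMap.ker (complexBetti.restrictCompl X Z i).hom ≤
      LinearMap.ker (complexBetti.restrictCompl X Z' i).hom := by
  intro x hx
  let g : C(complexPointsCompl X Z', complexPointsCompl X Z) :=
    ⟨fun P ↦ ⟨P.1, fun hP ↦ P.2 (h hP)⟩, by fun_prop⟩
  have hfac : complexBetti.restrictCompl X Z' i =
      complexBetti.restrictCompl X Z i ≫ singularCohomology.map ℂ ℂ g i := by
    rw [complexBetti.restrictCompl, complexBetti.restrictCompl, ← singularCohomology.map_comp]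
    rfl
  rw [LinearMap.mem_ker] at hx ⊢
  change complexBetti.restrictCompl X Z' i x = 0
  rw [hfac, ModuleCat.comp_apply]
  change singularCohomology.map ℂ ℂ g i (complexBetti.restrictCompl X Z i x) = 0
  rw [show complexBetti.restrictCompl X Z i x = 0 from hx, map_zero]

/-- **Zariski-dense is analytically dense on an irreducible subvariety** (SGA1 XII Prop. 2.2): for
`Z ⊆ X` closed irreducible and `R` closed with `Z ⊄ R`, every open set of `X(ℂ)` containing a
complex point of `Z` contains a complex point of `Z ∖ R`. [cite: SGA1, Exp. XII Prop. 2.2] -/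
theorem exists_mem_pt_mem_pt_not_mem {n : ℕ} {X : SchemeOver ℂ} (hX : IsSmoothProjective n X)
    {Z R : Set X.left} (hZ : IsClosed Z) (hZi : IsIrreducible Z) (hR : IsClosed R) (hZR : ¬ Z ⊆ R)
    {O : Set (ComplexPoints X)} (hO : IsOpen O) {P : ComplexPoints X} (hPO : P ∈ O)
    (hPZ : P.pt ∈ Z) : ∃ P' ∈ O, P'.pt ∈ Z ∧ P'.pt ∉ R := by
  haveI := hX.smoothOfRelativeDimension
  haveI : LocallyOfFiniteType X.hom := by
    haveI : Smooth X.hom := SmoothOfRelativeDimension.smooth n _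
    infer_instance
  haveI := IsSmoothProjective.isLocallyNoetherian_holds hX
  haveI := IsSmoothProjective.compactSpace_holds hX
  haveI : IsNoetherian X.left := {}
  haveI : NoetherianSpace ↥X.left := inferInstance
  have hret : ∀ U : Set X.left, IsOpen U → IsRetrocompact U :=
    fun U _ V _ _ ↦ NoetherianSpace.isCompact _
  have hT : Topology.IsLocallyConstructible (Z ∩ Rᶜ) := by
    refine (Topology.IsConstructible.inter ?_ ?_).isLocallyConstructible
    · rw [← compl_compl Z]
      exact (IsRetrocompact.isConstructible hZ.isOpen_compl (hret _ hZ.isOpen_compl)).compl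
    · exact IsRetrocompact.isConstructible hR.isOpen_compl (hret _ hR.isOpen_compl)
  have hdense : Z ⊆ closure (Z ∩ Rᶜ) :=
    subset_closure_inter_of_isPreirreducible_of_isOpen hZi.isPreirreducible hR.isOpen_compl (by
      obtain ⟨z, hz, hzR⟩ := Set.not_subset.1 hZR
      exact ⟨z, hz, hzR⟩)
  have hcl := ComplexPoints.preimage_pt_closure_eq X hT
  have hP : P ∈ closure (AlgPoints.pt ⁻¹' (Z ∩ Rᶜ) : Set (ComplexPoints X)) := by
    rw [← hcl]
    exact hdense hPZ
  obtain ⟨P', hP'O, hP'Z, hP'R⟩ := mem_closure_iff.1 hP O hO hPO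
  exact ⟨P', hP'O, hP'Z, hP'R⟩

/-- **(Θ) Transport of the Thom line along a finite map at a point where it is a local homeomorphism**
("`Z` appears with multiplicity one in `φ⁻¹(φ Z)`": Voisin II §9.2.4 proof of Lemma 9.22; Fulton
§19.1 eq. (3) `H²ˡ(X, X − V) ≅ H_{2n−2l}(V)` and Lemma 19.1.1; Hatcher §3.3 Lemma 3.27). For
`φ : X ⟶ Y` finite between smooth projective complex `n`-folds, `Z ⊆ X` irreducible closed of
codimension `≥ l ≥ 1`, `Z'` closed with `φ⁻¹(φ Z) ⊆ Z ∪ Z'`, and `φ(ℂ)` a local homeomorphism at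
ONE complex point of `Z` (hence, by `exists_mem_pt_mem_pt_not_mem`, at complex points of `Z` off any
closed `R ⊉ Z`): for every NON-ZERO `b ∈ H²ˡ(Y(ℂ); ℂ)` dying on `(Y ∖ φ Z)(ℂ)`, every class dying on
`(X ∖ Z)(ℂ)` is a multiple of `φ^* b` plus a class dying on `(X ∖ Z')(ℂ)`. Proof: off the closed bad
set `B = Z' ∪ Z₁ ∪ φ⁻¹(C₁)` (`Z₁ ⊊ Z`, `C₁ ⊊ C = φ Z` the non-straightened parts, codimension `≥ l + 1`,
`GAGADimension.exists_closed_straightening_off`) the subset `S = (Z ∖ B)(ℂ)` of `U = (X ∖ B)(ℂ)` is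
closed, connected, locally flat of real codimension `2l`; the topological Thom-line transport (T)
(`stub_thomLineTransport`, LANDED p140530) gives `ker (H²ˡ(U) → H²ˡ(U ∖ S)) ≤ ℂ · (φ^* b)|_U`, and
`ker_B ≤ ker_{Z'} ⊔ ker_{Z₁ ∪ φ⁻¹ C₁} = ker_{Z'}` (`ker_restrictCompl_union_le`, semipurity
`injective_restrictCompl_of_le_coheight`). PROVED (lead c2).
[cite: VoisinHodgeII2003, §9.2.4 proof of Lemma 9.22] [cite: Fulton1998, §19.1 Lemma 19.1.1] -/
theorem stub_coneTransport :
    ∀ ⦃n : ℕ⦄ ⦃X Y : SchemeOver ℂ⦄, IsSmoothProjective n X → IsSmoothProjective n Y →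
      ∀ (φ : X ⟶ Y) [IsFinite φ.left] ⦃l : ℕ⦄, 1 ≤ l →
      ∀ ⦃Z Z' : Set X.left⦄, IsClosed Z → IsIrreducible Z → (∀ z ∈ Z, (l : ℕ∞) ≤ coheight z) →
        IsClosed Z' → φ.left.base ⁻¹' (φ.left.base '' Z) ⊆ Z ∪ Z' →
        (∃ P : ComplexPoints X, P.pt ∈ Z ∧
          ∃ e : OpenPartialHomeomorph (ComplexPoints X) (ComplexPoints Y),
            P ∈ e.source ∧ Set.EqOn (AlgPoints.map φ) e e.source) →
        ∀ ⦃b : complexBetti Y (2 * l)⦄,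
          complexBetti.restrictCompl Y (φ.left.base '' Z) (2 * l) b = 0 → b ≠ 0 →
          LinearMap.ker (complexBetti.restrictCompl X Z (2 * l)).hom ≤
            Submodule.span ℂ {complexBetti.map φ (2 * l) b} ⊔
              LinearMap.ker (complexBetti.restrictCompl X Z' (2 * l)).hom := by
  intro n X Y hX hY φ _ l hl Z Z' hZ hZi hZl hZ'c hpre hloc b hb hb0
  -- trivial case `Z ⊆ Z'`
  by_cases hZZ' : Z ⊆ Z'
  · exact (ker_restrictCompl_mono hZZ' _).trans le_sup_right
  -- trivial case: no point of `Z` of codimension `≤ l` (semipurity)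
  by_cases hpt : ∃ z ∈ Z, coheight z ≤ (l : ℕ∞)
  swap
  · have h' : ∀ z ∈ Z, ((l + 1 : ℕ) : ℕ∞) ≤ coheight z := by
      intro z hz
      push Not at hpt
      have hlt := hpt z hz
      push_cast
      exact Order.add_one_le_of_lt hlt
    intro x hx
    have hinj := injective_restrictCompl_of_le_coheight hX hZ h' (i := 2 * l) (by omega)
    have h0 : x = 0 := hinj (by rw [LinearMap.mem_ker.1 hx, map_zero])
    rw [h0]
    exact Submodule.zero_mem _
  -- instances
  haveI := hX.smoothOfRelativeDimension
  haveI := hY.smoothOfRelativeDimension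
  haveI : LocallyOfFiniteType X.hom := by
    haveI : Smooth X.hom := SmoothOfRelativeDimension.smooth n _
    infer_instance
  haveI : LocallyOfFiniteType Y.hom := by
    haveI : Smooth Y.hom := SmoothOfRelativeDimension.smooth n _
    infer_instance
  haveI := IsSmoothProjective.compactSpace_holds hX
  haveI := IsSmoothProjective.compactSpace_holds hY
  haveI : SecondCountableTopology (ComplexPoints X) :=
    ComplexPoints.secondCountableTopology_of_compactSpace_holds X
  haveI : SecondCountableTopology (ComplexPoints Y) :=
    ComplexPoints.secondCountableTopology_of_compactSpace_holds Y
  -- the image `C = φ(Z)`: closed, irreducible, of codimension exactly `l`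
  set C : Set Y.left := φ.left.base '' Z with hCdef
  obtain ⟨hCc, hCi, hCl, hCl'⟩ := image_codim_of_isFinite hX hY φ hZ hZi hZl hpt
  -- straightenings off bad sets of codimension `≥ l + 1`
  obtain ⟨Z₁, hZ₁, hZ₁Z, hcZ₁, hstrZ⟩ := GAGADimension.exists_closed_straightening_off hX hZ hZl
  obtain ⟨C₁, hC₁, hC₁C, hcC₁, hstrC⟩ := GAGADimension.exists_closed_straightening_off hY hCc hCl
  -- the bad set `Bad = Z' ∪ (Z₁ ∪ φ⁻¹ C₁)`
  set B₂ : Set X.left := Z₁ ∪ φ.left.base ⁻¹' C₁ with hB₂def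
  have hB₂c : IsClosed B₂ := hZ₁.union (hC₁.preimage φ.left.continuous)
  have hcB₂ : ∀ z ∈ B₂, ((l + 1 : ℕ) : ℕ∞) ≤ coheight z := by
    rintro z (hz | hz)
    · exact hcZ₁ z hz
    · exact le_coheight_of_mem_preimage_of_isFinite hX hY φ hcC₁ hz
  set Bad : Set X.left := Z' ∪ B₂ with hBaddef
  have hBadc : IsClosed Bad := hZ'c.union hB₂c
  -- `Z ⊄ Bad`
  have hZB₂ : ¬ Z ⊆ B₂ := by
    intro hsub
    obtain ⟨z, hz, hzl⟩ := hpt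
    have h1 := hcB₂ z (hsub hz)
    have h2 : ((l + 1 : ℕ) : ℕ∞) ≤ (l : ℕ∞) := h1.trans hzl
    have h3 : l + 1 ≤ l := by exact_mod_cast h2
    omega
  -- `Z ⊄ Bad`, `C ⊄ C₁`
  have hZBad : ¬ Z ⊆ Bad := by
    intro hsub
    rcases (isPreirreducible_iff_isClosed_union_isClosed.1 hZi.isPreirreducible) Z' B₂ hZ'c hB₂c hsub
      with h | h
    · exact hZZ' h
    · exact hZB₂ h
  have hCC₁ : ¬ C ⊆ C₁ := by
    intro hsub
    obtain ⟨t, ht, htl⟩ := hCl'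
    have h2 := (hcC₁ t (hsub ht)).trans htl
    have h3 : l + 1 ≤ l := by exact_mod_cast h2
    omega
  -- a good point `P` where `φ(ℂ)` is a local homeomorphism
  obtain ⟨P₀, hP₀Z, e₀, hP₀e₀, hΦe₀⟩ := hloc
  obtain ⟨P, hPe₀, hPZ, hPBad⟩ :=
    exists_mem_pt_mem_pt_not_mem hX hZ hZi hBadc hZBad e₀.open_source hP₀e₀ hP₀Z
  -- the open sets `Ω = (X ∖ Bad)(ℂ)`, `Ω' = (Y ∖ C₁)(ℂ)` and the closed strata
  set Ω : Set (ComplexPoints X) := {P | P.pt ∉ Bad} with hΩdef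
  have hΩ : IsOpen Ω := isOpen_setOf_pt_not_mem hBadc
  set Ω' : Set (ComplexPoints Y) := {Q | Q.pt ∉ C₁} with hΩ'def
  have hΩ' : IsOpen Ω' := isOpen_setOf_pt_not_mem hC₁
  set Φ : C(ComplexPoints X, ComplexPoints Y) := AlgPoints.mapContinuous (L := ℂ) φ with hΦdef
  have hΦapp : ∀ Q, Φ Q = AlgPoints.map φ Q := fun Q ↦ rfl
  have hΦpt : ∀ Q : ComplexPoints X, (Φ Q).pt = φ.left.base Q.pt := fun Q ↦ rfl
  have hΦΩ : MapsTo Φ Ω Ω' := by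
    intro Q hQ hQ'
    refine hQ (Or.inr (Or.inr ?_))
    rw [mem_preimage, ← hΦpt]
    exact hQ'
  set ZZ : Set (ComplexPoints X) := {P | P.pt ∈ Z} with hZZdef
  have hZZc : IsClosed ZZ := ⟨AlgPoints.isOpen_setOf_pt_mem (X := X) (L := ℂ) ⟨Zᶜ, hZ.isOpen_compl⟩⟩
  set CC : Set (ComplexPoints Y) := {Q | Q.pt ∈ C} with hCCdef
  have hCCc : IsClosed CC := ⟨AlgPoints.isOpen_setOf_pt_mem (X := Y) (L := ℂ) ⟨Cᶜ, hCc.isOpen_compl⟩⟩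
  have hZC : MapsTo Φ ZZ CC := by
    intro Q hQ
    change (Φ Q).pt ∈ C
    rw [hΦpt]
    exact mem_image_of_mem _ hQ
  have hpreT : Ω ∩ Φ ⁻¹' CC ⊆ ZZ := by
    rintro Q ⟨hQΩ, hQC⟩
    have hQC' : φ.left.base Q.pt ∈ C := by rw [← hΦpt]; exact hQC
    rcases hpre hQC' with h | h
    · exact h
    · exact (hQΩ (Or.inl h)).elim
  -- preconnectedness of the strata (irreducibility)
  have hSc : IsPreconnected (Ω ∩ ZZ) := by
    have h := ComplexPoints.isConnected_setOf_pt_mem_inter_of_isIrreducible X hZ hZi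
      ⟨Badᶜ, hBadc.isOpen_compl⟩ (by
        obtain ⟨z, hz, hzB⟩ := not_subset.1 hZBad
        exact ⟨z, hz, hzB⟩)
    have hset : Ω ∩ ZZ = {P : ComplexPoints X | P.pt ∈ Z ∧ P.pt ∈ ((⟨Badᶜ, hBadc.isOpen_compl⟩ :
        X.left.Opens) : Set X.left)} := by
      ext Q
      exact ⟨fun hQ ↦ ⟨hQ.2, hQ.1⟩, fun hQ ↦ ⟨hQ.2, hQ.1⟩⟩
    rw [hset]
    exact h.isPreconnected
  have hS'c : IsPreconnected (Ω' ∩ CC) := by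
    have h := ComplexPoints.isConnected_setOf_pt_mem_inter_of_isIrreducible Y hCc hCi
      ⟨C₁ᶜ, hC₁.isOpen_compl⟩ (by
        obtain ⟨t, ht, htC⟩ := not_subset.1 hCC₁
        exact ⟨t, ht, htC⟩)
    have hset : Ω' ∩ CC = {Q : ComplexPoints Y | Q.pt ∈ C ∧ Q.pt ∈ ((⟨C₁ᶜ, hC₁.isOpen_compl⟩ :
        Y.left.Opens) : Set Y.left)} := by
      ext Q
      exact ⟨fun hQ ↦ ⟨hQ.2, hQ.1⟩, fun hQ ↦ ⟨hQ.2, hQ.1⟩⟩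
    rw [hset]
    exact h.isPreconnected
  -- topological local flatness of the strata off the bad sets
  have hfr : ∀ c' : ℕ, Module.finrank ℝ (Fin c' → ℂ) = 2 * c' := fun c' ↦ by
    rw [Module.finrank_pi_fintype, Finset.sum_const, Finset.card_univ, Fintype.card_fin,
      Complex.finrank_real_complex, smul_eq_mul, mul_comm]
  have hflat : ∀ x ∈ Ω ∩ ZZ, ∃ (F : Type) (_ : NormedAddCommGroup F) (_ : NormedSpace ℝ F)
      (_ : FiniteDimensional ℝ F) (K : Type) (_ : NormedAddCommGroup K) (_ : NormedSpace ℝ K)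
      (e : OpenPartialHomeomorph (ComplexPoints X) (F × K)),
      2 * l ≤ Module.finrank ℝ F ∧ x ∈ e.source ∧ ∀ z ∈ e.source, z ∈ ZZ ↔ (e z).1 = 0 := by
    rintro x ⟨hxΩ, hxZ⟩
    obtain ⟨c', K, e, hcc', hxe, he⟩ := hstrZ x hxZ (fun h ↦ hxΩ (Or.inr (Or.inl h)))
    refine ⟨Fin c' → ℂ, inferInstance, inferInstance, inferInstance, ↥K, inferInstance,
      inferInstance, e, ?_, hxe, fun z hz ↦ he z hz⟩
    rw [hfr]
    omega
  have hflat' : ∀ y ∈ Ω' ∩ CC, ∃ (F : Type) (_ : NormedAddCommGroup F) (_ : NormedSpace ℝ F)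
      (_ : FiniteDimensional ℝ F) (K : Type) (_ : NormedAddCommGroup K) (_ : NormedSpace ℝ K)
      (e : OpenPartialHomeomorph (ComplexPoints Y) (F × K)),
      2 * l ≤ Module.finrank ℝ F ∧ y ∈ e.source ∧ ∀ z ∈ e.source, z ∈ CC ↔ (e z).1 = 0 := by
    rintro y ⟨hyΩ, hyC⟩
    obtain ⟨c', K, e, hcc', hye, he⟩ := hstrC y hyC hyΩ
    refine ⟨Fin c' → ℂ, inferInstance, inferInstance, inferInstance, ↥K, inferInstance,
      inferInstance, e, ?_, hye, fun z hz ↦ he z hz⟩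
    rw [hfr]
    omega
  -- the good point read in `Ω`
  have hPΩ : P ∈ Ω := hPBad
  have hPZZ : P ∈ ZZ := hPZ
  have hΦe₀' : EqOn Φ e₀ e₀.source := fun Q hQ ↦ by rw [hΦapp]; exact hΦe₀ hQ
  -- the class `b` read on `Ω'`
  set bT : singularCohomology ℂ ℂ ↥Ω' (2 * l) := complexBetti.restrictCompl Y C₁ (2 * l) b
    with hbTdef
  have hbT0 : bT ≠ 0 := by
    intro h0
    have hinj := injective_restrictCompl_of_le_coheight hY hC₁ hcC₁ (i := 2 * l) (by omega)
    exact hb0 (hinj (by rw [map_zero]; exact h0))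
  have hbT : singularCohomology.map ℂ ℂ (subsetIncl {y : ↥Ω' | (y : ComplexPoints Y) ∉ CC})
      (2 * l) bT = 0 := by
    let g : C(↥{y : ↥Ω' | (y : ComplexPoints Y) ∉ CC}, complexPointsCompl Y C) :=
      ⟨fun Q ↦ ⟨Q.1.1, Q.2⟩, by fun_prop⟩
    have key : singularCohomology.map ℂ ℂ (subsetIncl {y : ↥Ω' | (y : ComplexPoints Y) ∉ CC})
        (2 * l) bT = singularCohomology.map ℂ ℂ g (2 * l) (complexBetti.restrictCompl Y C (2 * l) b) := by
      change (singularCohomology.map ℂ ℂ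
          (⟨Subtype.val, continuous_subtype_val⟩ : C(↥Ω', ComplexPoints Y)) (2 * l) ≫
        singularCohomology.map ℂ ℂ (subsetIncl {y : ↥Ω' | (y : ComplexPoints Y) ∉ CC}) (2 * l)) b =
        (singularCohomology.map ℂ ℂ
          (⟨Subtype.val, continuous_subtype_val⟩ : C(complexPointsCompl Y C, ComplexPoints Y)) (2 * l) ≫
        singularCohomology.map ℂ ℂ g (2 * l)) b
      rw [← singularCohomology.map_comp, ← singularCohomology.map_comp]
      rfl
    rw [key, hb, map_zero]
  -- the Thom-line transport (T)
  have hT := stub_thomLineTransport hΩ hΩ' Φ hΦΩ hZZc hCCc hZC hpreT hSc hS'c (k := 2 * l) (by omega) hflat hflat'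
    e₀ hΦe₀' hPe₀ hPΩ hPZZ hbT hbT0
  -- conclusion; read the restriction to `Ω = (X ∖ Bad)(ℂ)` as a linear map into `H(Ω)`
  set ρ : complexBetti X (2 * l) →ₗ[ℂ] singularCohomology ℂ ℂ ↥Ω (2 * l) :=
    (complexBetti.restrictCompl X Bad (2 * l)).hom with hρdef
  intro x hx
  have hx' : complexBetti.restrictCompl X Z (2 * l) x = 0 := LinearMap.mem_ker.1 hx
  have hxΩ : ρ x ∈ LinearMap.ker (singularCohomology.map ℂ ℂ
      (subsetIncl {x : ↥Ω | (x : ComplexPoints X) ∉ ZZ}) (2 * l)).hom := by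
    refine LinearMap.mem_ker.2 ?_
    let g : C(↥{x : ↥Ω | (x : ComplexPoints X) ∉ ZZ}, complexPointsCompl X Z) :=
      ⟨fun Q ↦ ⟨Q.1.1, Q.2⟩, by fun_prop⟩
    have key : singularCohomology.map ℂ ℂ (subsetIncl {x : ↥Ω | (x : ComplexPoints X) ∉ ZZ}) (2 * l)
        (ρ x) = singularCohomology.map ℂ ℂ g (2 * l) (complexBetti.restrictCompl X Z (2 * l) x) := by
      change (singularCohomology.map ℂ ℂ
          (⟨Subtype.val, continuous_subtype_val⟩ : C(↥Ω, ComplexPoints X)) (2 * l) ≫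
        singularCohomology.map ℂ ℂ (subsetIncl {x : ↥Ω | (x : ComplexPoints X) ∉ ZZ}) (2 * l)) x =
        (singularCohomology.map ℂ ℂ
          (⟨Subtype.val, continuous_subtype_val⟩ : C(complexPointsCompl X Z, ComplexPoints X)) (2 * l) ≫
        singularCohomology.map ℂ ℂ g (2 * l)) x
      rw [← singularCohomology.map_comp, ← singularCohomology.map_comp]
      rfl
    change singularCohomology.map ℂ ℂ (subsetIncl {x : ↥Ω | (x : ComplexPoints X) ∉ ZZ}) (2 * l)
        (ρ x) = 0
    rw [key, hx', map_zero]
  obtain ⟨r, hr⟩ := Submodule.mem_span_singleton.1 (hT hxΩ)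
  have hfb : singularCohomology.map ℂ ℂ (⟨fun x ↦ ⟨Φ x, hΦΩ x.2⟩, by fun_prop⟩ : C(↥Ω, ↥Ω')) (2 * l)
      bT = ρ (complexBetti.map φ (2 * l) b) := by
    change (singularCohomology.map ℂ ℂ
        (⟨Subtype.val, continuous_subtype_val⟩ : C(↥Ω', ComplexPoints Y)) (2 * l) ≫
      singularCohomology.map ℂ ℂ (⟨fun x ↦ ⟨Φ x, hΦΩ x.2⟩, by fun_prop⟩ : C(↥Ω, ↥Ω')) (2 * l)) b =
      (singularCohomology.map ℂ ℂ (AlgPoints.mapContinuous (L := ℂ) φ) (2 * l) ≫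
        singularCohomology.map ℂ ℂ
          (⟨Subtype.val, continuous_subtype_val⟩ : C(↥Ω, ComplexPoints X)) (2 * l)) b
    rw [← singularCohomology.map_comp, ← singularCohomology.map_comp]
    rfl
  have hdiff : ρ (x - r • complexBetti.map φ (2 * l) b) = 0 := by
    rw [map_sub, map_smul, ← hfb, hr, sub_self]
  have hmem : x - r • complexBetti.map φ (2 * l) b ∈
      LinearMap.ker (complexBetti.restrictCompl X Z' (2 * l)).hom := by
    have hsplit := ker_restrictCompl_union_le hX hZ'c hB₂c (c := l + 1) (fun t ht ↦ hcB₂ t ht.2)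
      (i := 2 * l) (by omega) (LinearMap.mem_ker.2 hdiff)
    obtain ⟨y, hy, z, hz, hyz⟩ := Submodule.mem_sup.1 hsplit
    have hz0 : z = 0 := by
      have hinj := injective_restrictCompl_of_le_coheight hX hB₂c hcB₂ (i := 2 * l) (by omega)
      exact hinj (by rw [LinearMap.mem_ker.1 hz, map_zero])
    rw [hz0, add_zero] at hyz
    rw [← hyz]
    exact hy
  refine Submodule.mem_sup.2 ⟨r • complexBetti.map φ (2 * l) b,
    Submodule.smul_mem _ _ (Submodule.subset_span rfl), _, hmem, ?_⟩
  abel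


end Summit.HodgeConjecture.HodgeConjecture.Theorems.HodgeBeyondAnchors

end
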